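import Mathlib
import HarnessLib
import HarnessLib.Audit
import Summits.PneNP.Statement
import Literature.Computability.Complexity.Circuit
import HarnessLib.Audit.Status.Attr
-- import Summits.PneNP.PneNP.Theorems.ConvexRankGatesCliqueBridge dropped: it (transitively) imports this route file — proofs used by `closes`/`_holds` must live in a module that does not import the Theses file
-- import Summits.PneNP.PneNP.Theorems.ConvexRankGatesThetaGateKillsRazborovPair dropped: it (transitively) imports this route file — proofs used by `closes`/`_holds` must live in a module that does not import the Theses file
-- import Summits.PneNP.PneNP.Theorems.ConvexRankGatesAssemblyRev5 dropped: it (transitively) imports this route file — proofs used by `closes`/`_holds` must live in a module that does not import the Theses file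

/-!
Route: ConvexRankGates

DORMANT since 2026-08-24T13:45:47Z (reconciler: no traction for 6.8 d (last activity item-evidence-added at 2026-08-17T17:48:24Z); parked, not closed — `ledger route dormant route-PneNP-ConvexRankGates --off` to reactivate) — unstaffed, not closed; items shared with open routes are served there. `ledger route dormant <id> --off` reactivates.

Route ConvexRankGates (card PneNP/PneNP/convex-rank-gates-planted-clique). It suffices to show
CAPTURE and LOWER BOUND for ONE extended monotone gate basis B_s = {AND2, OR2} + CONV_s + PERM_s +
GRANK_s, all gates monotone by syntax: CONV_s = SDP-feasibility gates v |-> [exists Y psd : tr(A_i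
Y) <= b_i + (B v)_i for all i] with B >= 0 and #constraints + dim Y <= s (LP = diagonal case =
Oliveira-Pudlak weak MLP gates; contains Lovasz theta thresholds and bipartite matching); PERM_s =
group-membership gates v |-> [tau in <sigma_i : v_i = 1>] for fixed permutations of <= s points
(abelian case = monotone span programs over Z/q: XOR-SAT, Cavalar-Oliveira GF(p) functions; rings
and nonabelian groups deliberately allowed); GRANK_s = symbolic-rank gates v |-> [rank over
Frac(F[x]) of K0 + sum_{v_i=1} x_i K_i >= theta], d x d matrices over any field F, d <= s
(Edmonds/Tutte/Lovasz: bipartite and general perfect matching, linear matroid intersection and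
parity are ONE gate; monotone because specialising x_i = 0 only lowers rank).
(Capture) exists a, every MONOTONE f : {0,1}^n -> {0,1} with a B2-circuit of size t has a
B_{(t+n+2)^a}-circuit with at most (t+n+2)^a gates.
(CliqueExtLowerBound) exists delta in (0,1/2), for every c, for all large m, no B_{m^c}-circuit with
<= m^c gates computes CLIQUE(m, ceil(m^delta)) (the clique function of the m(m-1)/2 edge indicators;
= Literature's cliqueFn m ceil(m^delta), written inline).
(CliqueBridge, support, provable now) if CLIQUE(m, ceil(m^delta)) has, for every c and all large m,
no B2-circuit with <= m^c gates, then PneNP (CLIQUE_mem_NP, NP_bool_eq_holds, P_bool_eq_holds,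
P_subset_PPoly_holds + input restriction of circuits — proved facts only).
Capture turns a polynomial B2-circuit for CLIQUE into a polynomial extended-monotone one,
contradicting the lower bound; so CLIQUE(m, ceil(m^delta)) has superpolynomial B2-complexity and
CliqueBridge gives P != NP. This implication is the route's DECIDING THEOREM `closes : Capture ->
CliqueExtLowerBound -> CliqueBridge -> PneNP`, PROVED in the route file (rev 3, D-0027 §2.1; 45
lines: monotonicity of CLIQUE, Capture applied to the B2-circuit, (t + #E(K_m) + 2)^a <= m^((c+3)a)
for m >= 3, gate classes monotone in s).
Lean (rev 3: the file imports only Literature.Computability.Complexity.Circuit — gate classes are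
inlined `let`s over Literature.Computability.Complexity.{GateFn, Circuit, B2}, Matrix.PosSemidef,
Subgroup.closure, Matrix.rank, FractionRing (MvPolynomial _ F); the clique function and the
clique/colouring test vectors are written inline, rfl-equal to Literature's cliqueFn / cliqueVec /
colorVec, so the route cone carries no unproved named fact): closes : Capture → CliqueExtLowerBound
→ CliqueBridge → PneNP (proved).
(rev 6, route-repair unused-crux) Cone glue: the support item MixedBasisSynthesis : ConvexGateBlind
→ LinAlgGateBlind → CliqueExtLowerBound (the alternation residual of the lower bound: sub-basis
blindness for the convex door and for the algebraic door separately upgrades to the mixed basis)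
connects cruxes #2 ConvexGateBlind and #4 LinAlgGateBlind to `closes` through its second hypothesis;
`closes` is unchanged and stays proved.

Rationale: WHY THIS LINE. Every monotone function in P known to need superpolynomial monotone circuits leaks
through CONVEXITY (Tardos1988: threshold of Lovasz theta, one SDP; bipartite matching = one LP gate,
OliveiraPudlak2019 Thm 5.2) or ALGEBRA (general matching 2^{n^Omega(1)} CavalarEtAl2026 but one
Tutte/Edmonds symbolic-rank test, Tutte1947/Edmonds1967; XOR-SAT in NC2,
GoosKamathRobereSokolov2019; GF(p) witnesses CavalarOliveira2023). Adjoin exactly these doors as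
wide monotone gates and split P != NP into a CAPTURE statement (no third door for monotone P/poly)
and a LOWER BOUND for CLIQUE in the enlarged model. Imports: extension complexity / size-to-degree
transfer (ChanEtAl2016, KothariMekaRaghavendra2017, LeeRaghavendraSteurer2015), SOS lower bounds
(BarakHopkinsKelnerKothariMoitraPotechin2019, JonesEtAl2022), approximation method (Razborov1985,
AlonBoppana1987), descriptive complexity as DESIGN GUIDE for the algebra door (FPC solves LPs,
AndersonDawarHolm2015; rank logic over FIELDS misses linear systems over Z_{2^i}, Lichter2023,
DawarGradelLichter2022 — hence PERM gates over rings/nonabelian groups, not field rank only;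
symmetric LPs ~ FPC, AtseriasDawarOchremiak2019).
REFEREE PAIR (modifies the card): Razborov's pair (k-cliques vs complete (k-1)-partite graphs) is
separated by ONE theta gate (Lovasz sandwich; filed as support ThetaGateKillsRazborovPair; cf. short
LS^4 proofs of clique-colouring, Krajicek2019 notes to Ch.18). Use POSITIVES = bare k-cliques
(minterms, so Alon-Boppana's positive-side analysis and the worst-case statement survive) and
NEGATIVES = dense Erdos-Renyi G(m, 1 - C ln m / k), k = m^delta: k-clique-free whp; sunflower
plucking keeps petal probability >= const for term size l <~ sqrt(k / ln m) (the Alon-Boppana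
regime); theta(complement) = Theta(sqrt(m k / ln m)) >> k (Cojaoghlan2005) and degree-D SOS cannot
refute independent sets of size m/(sqrt(d) log m D^c0) in the complement G(m, d/m) (JonesEtAl2022),
so CONV gates are provably blind at the single-relaxation level. The card's planted-vs-G(n,1/2) pair
is kept as the fallback (BHKKMP), but there the plain AND/OR step is itself open (Rossman2014 covers
constant k only).
RANKED CRUXES. #2 ConvexGateBlind — {AND2,OR2}+CONV circuits of poly size do not compute CLIQUE(m,
m^delta): the single-LP-gate case is OliveiraPudlak2019's open problem; handle =
per-dual-certificate Markov bound (one certificate rejects <= C ln m/k of the negatives) + a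
CLRS/LRS-type junta/psd-rank transfer with the product measure on the NEGATIVE side + JonesEtAl2022.
#3 Capture — most informative either way; a refutation names a third door. #4 LinAlgGateBlind —
{AND2,OR2}+PERM+GRANK: abelian single-gate case ~ monotone span programs (PitassiRobere2018 via
monotone reduction SAT->CLIQUE); GRANK single gate = a monotone-support variant of determinantal
complexity of the clique polynomial (VNP-complete, Burgisser2000). #5 CliqueExtLowerBound — the
load-bearing full-basis bound (alternations of CONV and algebra gates); needs #2, #4 and an
approximator that absorbs wide gates; with Capture and CliqueBridge it is a premise of `closes`, and
#2/#4 feed it through the glue item MixedBasisSynthesis : ConvexGateBlind → LinAlgGateBlind →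
CliqueExtLowerBound (rev 6; see TWO-LAYER PLAN) — conversely #5 → #2 and #5 → #4 are immediate
(sub-bases, IsOver.mono).
SUPPORT (sanity items validating the inline definitions — all PROVED by 2026-08-16): CliqueBridge
(superpolynomial B2 bound for the CLIQUE(m, ceil(m^delta)) family -> PneNP, via CLIQUE_mem_NP +
NP_bool_eq_holds + P_bool_eq_holds + P_subset_PPoly_holds + CircuitInputMap restriction; the third
hypothesis of the proved deciding theorem `closes`; cliqueBridge_proof), ThetaGateKillsRazborovPair
(CONV; in tree: lovaszTheta_compl_sandwich; thetaGateKillsRazborovPair_proof), XorUnsatIsOnePermGate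
(PERM; xorUnsatIsOnePermGate_proof), BpmIsOneRankGate (GRANK, Edmonds matrix;
bpmIsOneRankGate_proof). The Assembly item (rev 5: Capture → CliqueExtLowerBound → PneNP, i.e.
`closes` with the proved CliqueBridge discharged) is proved (convexRankGates_assembly_rev5_proof).
NOT provable now among the supports: the glue item MixedBasisSynthesis (rev 6, next paragraph).
TWO-LAYER PLAN. (rev 6, route-repair unused-crux) Glue item MixedBasisSynthesis : ConvexGateBlind →
LinAlgGateBlind → CliqueExtLowerBound (support, rank 9) — the ALTERNATION RESIDUAL of #5 over #2 and
#4 ('no synergy between the convex door and the algebraic door': blindness of poly-size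
{AND2,OR2}+CONV circuits and of poly-size {AND2,OR2}+PERM+GRANK circuits separately upgrades to the
mixed basis B_{m^c}). It puts #2 and #4 into the cone of `closes` (read backwards through the
implication item), so the lower-bound half of the thesis closes EITHER by #5 directly OR by #2 + #4
+ MixedBasisSynthesis; `closes` itself is unchanged. It is not a formality and not provable now: the
bare hypotheses give no black-box handle on circuits that interleave CONV with PERM/GRANK gates (an
SDP-feasibility gate reading GRANK outputs is neither door), and its honest discharge has the shape
all three planned lines of #5 already share (Cruxes/CliqueExtLowerBound/Lines/*): an ENGINE / host
theorem that passes a monotone gate of ANY class through a two-sided approximation at the price of a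
single-gate property charged to the referee measures (ICL in event-sandwich-interpolation;
Replaceable in the picked line width-threshold-certificate-sparsity — whose CONV instance
stub_convReplaceable was REFUTED 2026-08-16 by the anchored theta gate,
NegativeNote-stub_convReplaceable.md, the notion being too strong, repair pending;
CONV-homogenisation normal form + induction on the algebraic budget in convex-collapse-feature-rank,
whose base stub is #2 in collapsed distributional form), fed by the DISTRIBUTIONAL single-gate forms
of #2 and #4, of which the worst-case statements #2/#4 are shadows. Because the single-gate notion
is still moving (one-sided SG vs ICL vs repaired Replaceable), the foreseen glued split of #5 —
Engine + SingleGateConv + SingleGateAlg → CliqueExtLowerBound (k = 3) — is filed only after one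
engine stub has LANDED with a notion that survived the disprover; until then no second layer exists
and MixedBasisSynthesis closes in one line from whichever comes first: (a) a direct proof of #5, (b)
a landed engine + the single-gate properties of all three wide-gate families.
KILL CRITERIA. Capture refuted by an explicit monotone P-function (candidates: permutation-group
style doors are already inside PERM; open: K6-minor / linkless embeddability, submodular-flow
functions) closes the route unless the witness is itself convex/algebraic in a way a fourth gate
type absorbs WITHOUT touching #2/#4 (one repair allowed, then close). ConvexGateBlind refuted (a
poly monotone SDP gate computing CLIQUE exactly) kills the line and is news (NP in
SDP-feasibility/poly). A proof that size-to-degree transfer provably fails for feasibility-form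
gates demotes #2 below #4. Operational proxy for the Capture criterion (refuter passes A/C/D,
non-blocking objection on record): the third-door candidate LIN-UNSAT over Z/2^k with k = n^eps
(monotone, in P by Smith normal form, projects onto GKRS 3XOR-UNSAT) — a superpolynomial lower bound
for it against B_s-circuits refutes Capture AS TYPED (PERM_s hosts no element of order 2^k > s); the
designated single repair is re-typing PERM as membership in (Z/m)^d / GL_d(Z/m) with m of polynomial
bit-size, after which #4/#5 get stronger and are re-examined.
NOT DECOMPOSED YET. The gate-approximation lemma (how an (l,p)-approximator passes through a CONV or
GRANK gate), the exact delta, LP-before-SDP staging of #2, uniformity/bit-size of gate constants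
(model is non-uniform by design), slice-function shortcuts (Berkowitz1982) — all below the crux
layer; the engine/single-gate split of #5 (TWO-LAYER PLAN) waits for a landed engine stub, and the
approximator notion itself (one-sided SG / ICL / Replaceable, constant-locality currency) stays
line-level until then.
CHEAPEST FALSIFIER. One lookup and one known asymptotic, no new computation needed: (i) LOOKUP — a
psd- /LP-lift of size m^O(1) for SOME up-closed convex body sandwiched between conv{1_K : K a
ceil(m^delta)-clique} + R_+^E and the clique-free 0/1 points would refute ConvexGateBlind (#2) and
CliqueExtLowerBound (#5) at once; searched and open (OliveiraPudlak2019 p.3 + Thm 6.10, the 4 later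
works citing doi:10.1145/3337787; Yannakakis1991's n^O(log n) nonnegative factorisation of the
clique-vs-colouring slack matrix is exactly why Razborov's pair is abandoned and does not touch the
dense-random negatives). (ii) KNOWN ASYMPTOTICS — on the referee pair the first relaxation level is
already decided in print: theta(complement of G(m, 1 - C ln m/k)) = Theta(sqrt(mk/ln m)) >> k
(Cojaoghlan2005), so the theta gate ACCEPTS the negatives, and degree-D SOS cannot refute
independent sets below m/(sqrt(d) log m D^c0) >> k in the sparse complement (JonesEtAl2022); had
either inequality gone the other way the referee pair (not the line) would be dead. (iii) For
Capture the cheapest attack is the third door of KILL CRITERIA: of the three one-gate absorption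
checks for LIN-UNSAT over Z/2^k only the PERM_s one is immediate (element orders: no element of
order 2^k > s); the GRANK and CONV ones are open one-gate questions, the GRANK one guided by the
failure of field-rank logic on linear systems over Z_{2^i} (DawarGradelLichter2022, Lichter2023) and
the CONV one by integrality-blindness of LP/SDP feasibility — a negative answer to all three demotes
Capture-as-typed and triggers the PERM re-typing rather than closing the route.

Novelty: NOVELTY (search-before-claim 2026-08-15: lit frontier PneNP --since 2020 (hit: arXiv:2507.16105 =
CavalarEtAl2026), lit bridges PneNP --cross any (generic), lit search --hybrid 'monotone span
programs dependency programs' (Krajicek2019 pp.383-400 read), lit galaxy search --star all 'monotone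
linear programming circuits' (1 hit, Krajicek2019 Proof Complexity MLP section; galaxy then rc 75
twice), lit read doi:10.1145/3337787 pp.2-3,7-16 (OliveiraPudlak2019), arXiv:2104.12999 pp.1-3
(Lichter2023), arXiv:2111.09250 abstract (JonesEtAl2022); plus the card's two novelty audits
(gen0/gen1: galaxy 'monotone circuits with oracle gates' 0 hits, 'every monotone function in P' 0,
lit related doi:10.1145/3337787)).
Nearest prior art: OliveiraPudlak2019 (doi:10.1145/3337787) — monotone LINEAR-PROGRAMMING
gates/circuits = the LP half of CONV; BPM is one gate (Thm 5.2), real span programs inside (Thm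
5.4), lower bound for ONE weak MLP gate explicitly open and tied to 'extended formulations of all
separating polytopes' (p.3). Krajicek's clone/local-oracle monotone circuits (arXiv:1611.08680,
arXiv:1704.06241) — unstructured small-locality oracles. Monotone span programs (PitassiRobere2018,
doi:10.1145/3188745.3188914) = abelian PERM gates as the whole device. Descriptive-complexity
capture programme (AndersonDawarHolm2015, AtseriasDawarOchremiak2019, Lichter2023,
DawarGradelLichter2022) — symmetric/choiceless, not monotone.
Delta (new-combination, with two new-mechanism-flavoured ingredients  [refs: 10.1145/3337787, 10.1145/3188745.3188914, 2507.16105, 2104.12999, 2111.09250, 1611.08680, 1704.06241, doi:10.1145/3337787, doi:10.1145/3188745.3188914, CavalarEtAl2026, Krajicek2019, OliveiraPudlak2019, Lichter2023, JonesEtAl2022, PitassiRobere2018, AndersonDawarHolm2015, AtseriasDawarOchremiak2019, DawarGradelLichter2022, AlonBoppana1987, Cojaoghlan2005]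

Barriers (technique_class: monotone-circuit-lower-bounds, approximation-method): technique_class: monotone-circuit-lower-bounds, approximation-method
Literature.Barriers.PneNP.MonotoneGap: applies head-on to any monotone-to-general transfer
(Tardos1988, Razborov1985b; MonotoneGap.not_monotoneTransfer_pow; sharpened by CavalarEtAl2026).
Evaded BY CONSTRUCTION: every recorded gap witness (theta threshold, bipartite and general perfect
matching, XOR-SAT, Cavalar-Oliveira GF(p) functions) is ONE gate of the basis (support items
ThetaGateKillsRazborovPair, BpmIsOneRankGate, XorUnsatIsOnePermGate make three of them
Lean-provable); the claim that no further witness exists is filed as the refutable crux Capture, not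
assumed.
Literature.Barriers.PneNP.ApproximationMethodLimit: Razborov1989/Pich2024 cap rho(f, M) <= O(n n0)
is for LEGITIMATE MODELS OVER A COMPLETE BASIS with negation; the lower-bound cruxes (#2, #4, #5)
are over an incomplete monotone basis with structured wide gates, where the cap does not apply (the
monotone CLIQUE bounds themselves live there). It WOULD bite if one tried to prove NP not in P/poly
by approximators directly; generality is routed through Capture (a simulation statement), not
through approximating De Morgan circuits.
Literature.Barriers.PneNP.NaturalProofs: the lower-bound cruxes concern a restricted monotone model
and explicit samplable test distributions; an approximation-method proof there is constructive/large
but harmless (no PRF candidates are monotone extended circuits; RazborovRudich1997 Thm 4.1 needs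
usefulness against P/po

History (route lifecycle, newest last):
- 2026-08-15T16:21:04Z · rev 2: restated ConvexGateBlind (stmt-PneNP-2658), LinAlgGateBlind (stmt-PneNP-2660), CliqueExtLowerBound (stmt-PneNP-2661), CliqueBridge (stmt-PneNP-2662), ThetaGateKillsRazborovPair (stmt-PneNP-2663) — route-repair (rbadge g2, step 1/2): restate 5 items so the route file can shed the imports CircuitLowerBounds / Cliq (planner-rbadge-PneNP-ConvexRankGates-8496846d-g2-0)
- 2026-08-15T22:50:14Z · rev 5: restated Assembly (stmt-PneNP-2666 proved) — route-repair rev 5 (glue-native-fail; planner-rglue-PneNP-ConvexRankGates-8496846d-0): deciding theorem `closes : Capture → CliqueExtLowerBound → CliqueBridge → (planner-rglue-PneNP-ConvexRankGates-8496846d-0)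
- 2026-08-24T13:45:47Z · DORMANT — reconciler: no traction for 6.8 d (last activity item-evidence-added at 2026-08-17T17:48:24Z); parked, not closed — `ledger route dormant route-PneNP-ConvexRank (operator:999:2041320)

sub-problem: PneNP · status: dormant · opened planner-plancard-PneNP-PneNP-convex-rank-gate-52d629f1-0 2026-08-15T11:06:46Z · rev 6 · ledger route-PneNP-ConvexRankGates
GENERATED by the gate from the ledger (D-0016/17). Provers cite these decls: `theorem foo : Summit.PneNP.PneNP.Theses.ConvexRankGates.<Decl> := …` in Summits/PneNP/PneNP/Theorems/<Name>.lean.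
-/

namespace Summit.PneNP.PneNP.Theses.ConvexRankGates

open scoped BigOperators Topology Manifold Classical MeasureTheory ProbabilityTheory Matrix InnerProductSpace ComplexConjugate ContinuousMap
open Filter Set Function TopologicalSpace MeasureTheory

attribute [summit_statement] _root_.PneNP

open Literature.PNP

-- earlier ConvexGateBlind (stmt-PneNP-2658, replaced 2026-08-15T16:21:04Z -> stmt-PneNP-10680): retired by None — let Conv : ℕ → Set Literature.Computability.Complexity.GateFn := fun s => {g | ∃ (p q : ℕ), p + q ≤ s ∧ ∃ (A : Fin p → Matrix (Fin q) (Fin q) ℝ) (b : Fin p → ℝ) (B : Fin p → Fin g.1 → ℝ), (∀ i j, 0 ≤ B i j) ∧ ∀ v : Fin g.1 → Bool, g.2 v = true ↔ ∃ Y : Matrix (Fin q) (Fin q) ℝ, Y.PosSemid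
/-- item stmt-PneNP-10680 · crux · rank 2 · open · by planner
why it might fail: AND/OR+CONV circuits collapse to ONE poly CONV gate (OP2019 Thm 4.3 trick; psd cone homogeneous), so this IS a psd-lift bound for EVERY up-closed convex separator of k-cliques from clique-free graphs: open even for one LP gate (OP2019 p.3, Thm 6.10); theta sits inside; CLRS/LRS need CSP symmetry.
sources: OliveiraPudlak2019, ChanEtAl2016, LeeRaghavendraSteurer2015, KothariMekaRaghavendra2017, BraunPokuttaZink2015, JonesEtAl2022
[crux] No polynomial-size monotone circuit over {AND2, OR2} plus CONV gates (monotone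
SDP-feasibility gates v |-> [exists Y psd : tr(A_i Y) <= b_i + (B v)_i], B >= 0, #constraints + dim
Y <= m^c; LP = diagonal case = Oliveira-Pudlak weak MLP gates) computes CLIQUE(m, ceil(m^delta)) (=
cliqueFn m ceil(m^delta), written inline), for some delta in (0,1/2) and every c, eventually in m.
The single-LP-gate case is the open problem of OliveiraPudlak2019 (p.3); AND/OR+CONV circuits
collapse to ONE poly-size CONV gate (OP2019 Thm 4.3 weak-wire trick, homogeneous psd cone), so this
is a psd-lift lower bound for EVERY up-closed convex separator of k-clique indicators from
k-clique-free graphs. Intended method: positives = bare k-cliques, negatives = dense G(m, 1 - C ln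
m/k); a rejecting dual certificate of a feasibility gate is a nonnegative edge weighting, and each
such certificate rejects at most a C ln m/k fraction of the negatives (Markov), so the size bound is
a nonnegative- /psd-rank bound for the certificate matrix with a PRODUCT measure on the negative
side: transplant the CLRS/KMR/LRS junta and psd-rank transfers (ChanEtAl2016,
KothariMekaRaghavendra2017, LeeRaghavendraSteurer2015) an -/
@[route_item "route-PneNP-ConvexRankGates"]
def ConvexGateBlind : Prop :=
  let Conv : ℕ → Set Literature.Computability.Complexity.GateFn := fun s => {g | ∃ (p q : ℕ), p + q ≤ s ∧ ∃ (A : Fin p → Matrix (Fin q) (Fin q) ℝ) (b : Fin p → ℝ) (B : Fin p → Fin g.1 → ℝ), (∀ i j, 0 ≤ B i j) ∧ ∀ v : Fin g.1 → Bool, g.2 v = true ↔ ∃ Y : Matrix (Fin q) (Fin q) ℝ, Y.PosSemidef ∧ ∀ i, (A i * Y).trace ≤ b i + ∑ j, B i j * (if v j then (1 : ℝ) else 0)}; ∃ δ : ℝ, 0 < δ ∧ δ < 1 / 2 ∧ ∀ c : ℕ, ∀ᶠ m : ℕ in atTop, ∀ C : Literature.Computability.Complexity.Circuit ((⊤ :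 SimpleGraph (Fin m)).edgeSet), C.IsOver ({Literature.Computability.Complexity.GateFn.and 2, Literature.Computability.Complexity.GateFn.or 2} ∪ Conv (m ^ c)) → C.size ≤ m ^ c → ¬ C.Computes (fun x => decide (¬ (SimpleGraph.fromEdgeSet {e : Sym2 (Fin m) | ∃ h : e ∈ (⊤ : SimpleGraph (Fin m)).edgeSet, x ⟨e, h⟩ = true}).CliqueFree ⌈(m : ℝ) ^ δ⌉₊))

/-- item stmt-PneNP-2659 · crux · rank 3 · open · by planner
why it might fail: Third door: LIN-UNSAT over Z/2^k, k=n^eps (monotone; P by Smith normal form; projects onto GKRS 3XOR-SAT, so superpoly monotone): PERM_s as typed has no element of order 2^k>s, CONV is integrality-blind, GRANK is field rank. Also H-minor containment, linkless embedding, submodular-flow thresholds.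
sources: GoosKamathRobereSokolov2019, KannanBachem1979, Lichter2023, DawarGradelLichter2022, OliveiraPudlak2019, CavalarEtAl2026
[crux] CAPTURE: there is an exponent a such that every MONOTONE Boolean function on a finite input
type with a B2-circuit of size t (n inputs) has a circuit with <= (t+n+2)^a gates over the extended
monotone basis B_{(t+n+2)^a} = {AND2, OR2} + CONV (SDP-feasibility, B >= 0) + PERM (membership of a
fixed permutation in the group generated by the selected permutations of <= s points; abelian case =
span programs over Z/q) + GRANK (threshold on the generic rank over Frac(F[x]) of K0 + sum_{selected
i} x_i K_i, any field F, dimension <= s). The convex/algebraic analogue of Markov-Fischer negation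
elimination; it holds for every monotone-gap witness in print: Tardos's theta threshold (one CONV
gate), bipartite matching (OliveiraPudlak2019 Thm 5.2; one GRANK gate, Edmonds1967), general perfect
matching (2^{n^Omega(1)} monotone, CavalarEtAl2026; one Tutte-matrix GRANK gate, Tutte1947), XOR-SAT
(GoosKamathRobereSokolov2019; one PERM gate), Cavalar-Oliveira GF(p) witnesses
(CavalarOliveira2023), non-planarity (Hanani-Tutte GF(2) system, Schaefer2013), linear matroid
intersection/parity (generic rank). PERM is over groups/rings rather than field rank because rank
logic over fields fails exac -/
@[route_item "route-PneNP-ConvexRankGates", crux]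
def Capture : Prop :=
  let Ext : ℕ → Set Literature.Computability.Complexity.GateFn := fun s => {g | g = Literature.Computability.Complexity.GateFn.and 2 ∨ g = Literature.Computability.Complexity.GateFn.or 2 ∨ (∃ (p q : ℕ), p + q ≤ s ∧ ∃ (A : Fin p → Matrix (Fin q) (Fin q) ℝ) (b : Fin p → ℝ) (B : Fin p → Fin g.1 → ℝ), (∀ i j, 0 ≤ B i j) ∧ ∀ v : Fin g.1 → Bool, g.2 v = true ↔ ∃ Y : Matrix (Fin q) (Fin q) ℝ, Y.PosSemidef ∧ ∀ i, (A i * Y).trace ≤ b i + ∑ j, B i j * (if v j then (1 : ℝ) else 0)) ∨ (∃ d : ℕ, d ≤ s ∧ ∃ (σ : Fin g.1 → Equiv.Perm (Fin d)) (τ : Equiv.Perm (Fin d)), ∀ v : Fin g.1 → Bool, g.2 v = true ↔ τ ∈ Subgroup.closure (σ '' {i | v i = true})) ∨ (∃ (F : Type) (_ : Field F) (d θ : ℕ), d ≤ s ∧ ∃ (K₀ : Matrix (Fin d) (Fin d) F) (K : Fin g.1 → Matrix (Fin d) (Fin d) F), ∀ v : Fin g.1 → Bool, g.2 v = true ↔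 θ ≤ (K₀.map (algebraMap F (FractionRing (MvPolynomial (Fin g.1) F))) + ∑ i, if v i then (algebraMap (MvPolynomial (Fin g.1) F) (FractionRing (MvPolynomial (Fin g.1) F)) (MvPolynomial.X i)) • (K i).map (algebraMap F (FractionRing (MvPolynomial (Fin g.1) F))) else 0).rank)}; ∃ a : ℕ, ∀ (ι : Type) (_ : Fintype ι) (f : (ι → Bool) → Bool), Monotone f → ∀ C : Literature.Computability.Complexity.Circuit ι, C.IsOver Literature.Computability.Complexity.B2 → C.Computes f → ∃ C' : Literature.Computability.Complexity.Circuit ι, C'.IsOver (Ext ((C.size + Fintype.card ι + 2) ^ a)) ∧ C'.size ≤ (C.size + Fintype.card ι + 2) ^ a ∧ C'.Computes f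

-- earlier LinAlgGateBlind (stmt-PneNP-2660, replaced 2026-08-15T16:21:04Z -> stmt-PneNP-10681): retired by None — let Lin : ℕ → Set Literature.Computability.Complexity.GateFn := fun s => {g | (∃ d : ℕ, d ≤ s ∧ ∃ (σ : Fin g.1 → Equiv.Perm (Fin d)) (τ : Equiv.Perm (Fin d)), ∀ v : Fin g.1 → Bool, g.2 v = true ↔ τ ∈ Subgroup.closure (σ '' {i | v i = true})) ∨ (∃ (F : Type) (_ : Field F) (d θ : ℕ), d ≤ s
/-- item stmt-PneNP-10681 · crux · rank 4 · open · by planner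
why it might fail: No technique for nonabelian group-membership or symbolic-rank gates INSIDE circuits: span-program bounds (rank measure, lifting; PitassiRobere2018) treat the algebraic device as the whole computation; PERM/GRANK do not collapse to one gate as CONV does; wild-constant GRANK may sit outside P/poly.
sources: PitassiRobere2018, Burgisser2000, Valiant1979, Krajicek2019, FurstHopcroftLuks1980, GoosKamathRobereSokolov2019
[crux] No polynomial-size monotone circuit over {AND2, OR2} plus PERM gates (group membership on <=
m^c points) and GRANK gates (generic-rank thresholds of dimension <= m^c over any field) computes
CLIQUE(m, ceil(m^delta)) (= cliqueFn m ceil(m^delta), written inline), for some delta in (0,1/2) and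
every c, eventually. Single abelian PERM gate = monotone span program over Z/q, where exponential
lower bounds exist (PitassiRobere2018, transferred to CLIQUE by the monotone AND-projection SAT ->
CLIQUE); single GRANK gate = the statement that k-clique edge sets are not the minimal monomial
supports of the large minors of a poly-size symbolic matrix linear in the edge variables — a
monotone-SUPPORT cousin of determinantal complexity of the clique polynomial (VNP-complete:
Burgisser2000, Valiant1979); nearest models: span and dependency programs (Krajicek2019 pp.383-407).
TAME sub-basis (PERM always; GRANK over Q/F_q with bit-size <= s) is P/poly-evaluable, so the tame
restriction follows from the hypothesis of CliqueBridge; the statement as typed is stronger only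
through WILD field constants (refuter pass G3). Method: the same referee pair (bare cliques vs dense
G(m, 1 - C ln m/k)); clos -/
@[route_item "route-PneNP-ConvexRankGates"]
def LinAlgGateBlind : Prop :=
  let Lin : ℕ → Set Literature.Computability.Complexity.GateFn := fun s => {g | (∃ d : ℕ, d ≤ s ∧ ∃ (σ : Fin g.1 → Equiv.Perm (Fin d)) (τ : Equiv.Perm (Fin d)), ∀ v : Fin g.1 → Bool, g.2 v = true ↔ τ ∈ Subgroup.closure (σ '' {i | v i = true})) ∨ (∃ (F : Type) (_ : Field F) (d θ : ℕ), d ≤ s ∧ ∃ (K₀ : Matrix (Fin d) (Fin d) F) (K : Fin g.1 → Matrix (Fin d) (Fin d) F), ∀ v : Fin g.1 → Bool, g.2 v = true ↔ θ ≤ (K₀.map (algebraMap F (FractionRing (MvPolynomial (Fin g.1) F))) + ∑ i, if v i then (algebraMap (MvPolynomial (Fin g.1) F) (FractionRing (MvPolynomial (Fin g.1) F)) (MvPolynomial.X i)) • (K i).map (algebraMap F (FractionRing (MvPolynomial (Fin g.1) F))) else 0).rank)}; ∃ δ : ℝ, 0 < δ ∧ δ < 1 / 2 ∧ ∀ c :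 ℕ, ∀ᶠ m : ℕ in atTop, ∀ C : Literature.Computability.Complexity.Circuit ((⊤ : SimpleGraph (Fin m)).edgeSet), C.IsOver ({Literature.Computability.Complexity.GateFn.and 2, Literature.Computability.Complexity.GateFn.or 2} ∪ Lin (m ^ c)) → C.size ≤ m ^ c → ¬ C.Computes (fun x => decide (¬ (SimpleGraph.fromEdgeSet {e : Sym2 (Fin m) | ∃ h : e ∈ (⊤ : SimpleGraph (Fin m)).edgeSet, x ⟨e, h⟩ = true}).CliqueFree ⌈(m : ℝ) ^ δ⌉₊))

-- earlier CliqueExtLowerBound (stmt-PneNP-2661, replaced 2026-08-15T16:21:04Z -> stmt-PneNP-10682): retired by None — let Ext : ℕ → Set Literature.Computability.Complexity.GateFn := fun s => {g | g = Literature.Computability.Complexity.GateFn.and 2 ∨ g = Literature.Computability.Complexity.GateFn.or 2 ∨ (∃ (p q : ℕ), p + q ≤ s ∧ ∃ (A : Fin p → Matrix (Fin q) (Fin q) ℝ) (b : Fin p → ℝ) (B : Fin p → F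
/-- item stmt-PneNP-10682 · crux · rank 5 · open · by planner
why it might fail: Needs approximators closed under BOTH convex and algebraic wide gates with alternation: even given #2 and #4, an SDP gate reading GRANK outputs has no decomposition theory; fan-in reduction to monotone real circuits costs n^(k-2) (HrubesPudlak2018), so Pudlak/Haken-Cook bounds do not transfer.
sources: Razborov1985, AlonBoppana1987, OliveiraPudlak2019, HrubesPudlak2018, JonesEtAl2022, BarakHopkinsKelnerKothariMoitraPotechin2019
[crux] The load-bearing lower bound over the FULL basis: for some delta in (0,1/2) and every c,
eventually in m, no circuit with <= m^c gates over B_{m^c} = {AND2, OR2} + CONV_{m^c} + PERM_{m^c} +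
GRANK_{m^c} computes CLIQUE(m, ceil(m^delta)) (= cliqueFn m ceil(m^delta), written inline). Implies
ConvexGateBlind and LinAlgGateBlind (sub-bases; refuter glue G1.lean/W1.lean by IsOver.mono); with
Capture and CliqueBridge it gives PneNP — this is the route's PROVED deciding theorem `closes :
Capture -> CliqueExtLowerBound -> CliqueBridge -> PneNP` (rev 2). It is NOT implied by NP not in
P/poly (gates may exceed P/poly: exact SDP feasibility, non-uniform field constants) — it is a claim
about a wide-but-monotone model, supported by the heuristic that every gate with rational poly-bit
data is efficiently computable and blind on the referee pair (bare m^delta-cliques vs G(m, 1 - C ln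
m/k): AND/OR by Alon-Boppana plucking with petal probability >= const for term size <~ sqrt(k/ln m);
CONV by Cojaoghlan2005 + JonesEtAl2022; planted-vs-G(n,1/2) with
BarakHopkinsKelnerKothariMoitraPotechin2019 as fallback). Needs an approximator notion that passes
through wide gates and survives alternation. [ -/
@[route_item "route-PneNP-ConvexRankGates", crux]
def CliqueExtLowerBound : Prop :=
  let Ext : ℕ → Set Literature.Computability.Complexity.GateFn := fun s => {g | g = Literature.Computability.Complexity.GateFn.and 2 ∨ g = Literature.Computability.Complexity.GateFn.or 2 ∨ (∃ (p q : ℕ), p + q ≤ s ∧ ∃ (A : Fin p → Matrix (Fin q) (Fin q) ℝ) (b : Fin p → ℝ) (B : Fin p → Fin g.1 → ℝ), (∀ i j, 0 ≤ B i j) ∧ ∀ v : Fin g.1 → Bool, g.2 v = true ↔ ∃ Y : Matrix (Fin q) (Fin q) ℝ, Y.PosSemidef ∧ ∀ i, (A i * Y).trace ≤ b i + ∑ j, B i j * (if v j then (1 : ℝ) else 0)) ∨ (∃ d : ℕ, d ≤ s ∧ ∃ (σ : Fin g.1 → Equiv.Perm (Fin d)) (τ : Equiv.Perm (Fin d)),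 ∀ v : Fin g.1 → Bool, g.2 v = true ↔ τ ∈ Subgroup.closure (σ '' {i | v i = true})) ∨ (∃ (F : Type) (_ : Field F) (d θ : ℕ), d ≤ s ∧ ∃ (K₀ : Matrix (Fin d) (Fin d) F) (K : Fin g.1 → Matrix (Fin d) (Fin d) F), ∀ v : Fin g.1 → Bool, g.2 v = true ↔ θ ≤ (K₀.map (algebraMap F (FractionRing (MvPolynomial (Fin g.1) F))) + ∑ i, if v i then (algebraMap (MvPolynomial (Fin g.1) F) (FractionRing (MvPolynomial (Fin g.1) F)) (MvPolynomial.X i)) • (K i).map (algebraMap F (FractionRing (MvPolynomial (Fin g.1) F))) else 0).rank)}; ∃ δ : ℝ, 0 < δ ∧ δ < 1 / 2 ∧ ∀ c : ℕ, ∀ᶠ m : ℕ in atTop, ∀ C : Literature.Computability.Complexity.Circuit ((⊤ : SimpleGraph (Fin m)).edgeSet), C.IsOver (Ext (m ^ c)) → C.size ≤ m ^ c → ¬ C.Computes (fun x => decide (¬ (SimpleGraph.fromEdgeSet {e : Sym2 (Fin m) | ∃ h : e ∈ (⊤ : SimpleGraph (Fin m)).edgeSet, x ⟨e, h⟩ =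 true}).CliqueFree ⌈(m : ℝ) ^ δ⌉₊))

-- earlier CliqueBridge (stmt-PneNP-2662, replaced 2026-08-15T16:21:04Z -> stmt-PneNP-10683): retired by None — (∃ δ : ℝ, 0 < δ ∧ δ < 1 / 2 ∧ ∀ c : ℕ, ∀ᶠ m : ℕ in atTop, ∀ C : Literature.Computability.Complexity.Circuit ((⊤ : SimpleGraph (Fin m)).edgeSet), C.IsOver Literature.Computability.Complexity.B2 → C.size ≤ m ^ c → ¬ C.Computes (Literature.Computability.Complexity.cliqueFn m ⌈(m : ℝ) ^ δ⌉₊)) →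
/-- item stmt-PneNP-10683 · support · rank 9 · closed · proved by Summit.PneNP.PneNP.Theorems.cliqueBridge_proof @ d997b4d7f716 (prover) · by planner
sources: AroraBarak2009, Karp1972
[support] If for some delta in (0,1/2) the functions CLIQUE(m, ceil(m^delta)) (= cliqueFn m
ceil(m^delta), written inline, rfl-equal) have, for every c and all large m, no B2-circuit with <=
m^c gates, then P != NP (the summit statement PneNP; rev 2 concludes PneNP directly instead of
NPNotSubsetPPoly so that the route file needs no import of ClayProblem.lean — the statement is
WEAKER than rev 1's, the natural proof still passes through NP not-subset P/poly). Proof sketch: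
assume not PneNP, i.e. every L in NP Bool (Wave0) lies in P Bool (Wave0); CLIQUE ∈ NP
(CLIQUE_mem_NP, KarpCliqueNP.lean; bridge NP_bool_eq_holds, ClayProblemProofs.lean) hence CLIQUE ∈ P
(P_bool_eq_holds) ⊆ PPoly (P_subset_PPoly_holds, CircuitClassesUniformProofs.lean), i.e. CLIQUE ∈
SIZE(p) for a polynomial p; at the code length of (⟨m, G⟩, k) under encodingGraph.pairBool
encodingNatBool (adjacency bits of G doubled inside boolPair; the codes of m and of k =
ceil(m^delta) hardwired) restrict the slice circuit with an input map (CircuitInputMap.lean /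
CircuitPlug.lean): the 4 positions carrying edge {i,j} go to that edge variable, every other
position to a constant gate (arity-0 gates are in B2), giving a B2-circ -/
@[route_item "route-PneNP-ConvexRankGates", crux]
def CliqueBridge : Prop :=
  (∃ δ : ℝ, 0 < δ ∧ δ < 1 / 2 ∧ ∀ c : ℕ, ∀ᶠ m : ℕ in atTop, ∀ C : Literature.Computability.Complexity.Circuit ((⊤ : SimpleGraph (Fin m)).edgeSet), C.IsOver Literature.Computability.Complexity.B2 → C.size ≤ m ^ c → ¬ C.Computes (fun x => decide (¬ (SimpleGraph.fromEdgeSet {e : Sym2 (Fin m) | ∃ h : e ∈ (⊤ : SimpleGraph (Fin m)).edgeSet, x ⟨e, h⟩ = true}).CliqueFree ⌈(m : ℝ) ^ δ⌉₊))) → PneNP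

-- earlier ThetaGateKillsRazborovPair (stmt-PneNP-2663, replaced 2026-08-15T16:21:04Z -> stmt-PneNP-10684): retired by None — let Conv : ℕ → Set Literature.Computability.Complexity.GateFn := fun s => {g | ∃ (p q : ℕ), p + q ≤ s ∧ ∃ (A : Fin p → Matrix (Fin q) (Fin q) ℝ) (b : Fin p → ℝ) (B : Fin p → Fin g.1 → ℝ), (∀ i j, 0 ≤ B i j) ∧ ∀ v : Fin g.1 → Bool, g.2 v = true ↔ ∃ Y : Matrix (Fin q) (Fin q) ℝ,
/-- item stmt-PneNP-10684 · support · rank 9 · closed · proved by Summit.PneNP.PneNP.Theorems.thetaGateKillsRazborovPair_proof (prover) · by planner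
sources: Lovasz1979, Jukna2012, Tardos1988
[support] Sanity of the CONV gate and the reason Razborov's test pair must be abandoned: for 2 <= k
<= m one CONV gate of description <= 4m^2+4 — the Lovasz-theta-type SDP [exists Y psd : tr Y = 1,
<J,Y> >= k, -[ab edge] <= Y_ab <= [ab edge] for a != b] — accepts every k-clique input (the clique
vector of S, #S = k) and rejects every complete (k-1)-partite input (the colouring vector of h : Fin
m -> Fin (k-1)); rev 2 writes the two test vectors inline (fun e => decide (forall v in e, v in S))
and (fun e => !decide ((e.map h).IsDiag)), rfl-equal to
Literature.Computability.Complexity.cliqueVec S / colorVec h (planner DefEqCheck.lean rc 0), so the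
route file needs no import of CliqueTestGraphs.lean. Proof: Y = (1/k) 1_S 1_S^T is feasible; for a
(k-1)-colouring write Y = Gram(y_a) with y_a ⊥ y_b inside each colour class, u_c = sum over class c,
then <J,Y> = |sum_c u_c|^2 <= (k-1) sum_c |u_c|^2 = (k-1) tr Y < k (Cauchy-Schwarz) — the sandwich
omega <= theta(complement) <= chi (Lovasz1979; Jukna2012 §9.9; Tardos1988); in tree:
lovaszTheta_compl_sandwich, le_lovaszTheta_compl_of_isNClique, lovaszTheta_compl_le_of_coloring
(Literature/Combinatorics/SimpleGraph/LovaszTheta.lean) make this -/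
@[route_item "route-PneNP-ConvexRankGates"]
def ThetaGateKillsRazborovPair : Prop :=
  let Conv : ℕ → Set Literature.Computability.Complexity.GateFn := fun s => {g | ∃ (p q : ℕ), p + q ≤ s ∧ ∃ (A : Fin p → Matrix (Fin q) (Fin q) ℝ) (b : Fin p → ℝ) (B : Fin p → Fin g.1 → ℝ), (∀ i j, 0 ≤ B i j) ∧ ∀ v : Fin g.1 → Bool, g.2 v = true ↔ ∃ Y : Matrix (Fin q) (Fin q) ℝ, Y.PosSemidef ∧ ∀ i, (A i * Y).trace ≤ b i + ∑ j, B i j * (if v j then (1 : ℝ) else 0)}; ∀ (m k : ℕ), 2 ≤ k → k ≤ m → ∃ C : Literature.Computability.Complexity.Circuit ((⊤ : SimpleGraph (Fin m)).edgeSet), C.IsOver (Conv (4 * m ^ 2 + 4)) ∧ C.size = 1 ∧ (∀ S : Finset (Fin m), S.card = k → C.eval (fun e : (⊤ : SimpleGraph (Fin m)).edgeSet => decide (∀ v ∈ (e : Sym2 (Fin m)), v ∈ S)) = true) ∧ (∀ h : Fin m → Fin (k - 1), C.eval (fun e : (⊤ : SimpleGraph (Fin m)).edgeSet => !decide (((e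 : Sym2 (Fin m)).map h).IsDiag)) = false)

/-- item stmt-PneNP-14728 · support · rank 9 · open · by planner
sources: OliveiraPudlak2019, Jukna2012, Razborov1985, AlonBoppana1987, HrubesPudlak2018
[support] GLUE (route-repair rev 6, unused-crux; kind support — does not key staffing):
ConvexGateBlind → LinAlgGateBlind → CliqueExtLowerBound. The ALTERNATION RESIDUAL of crux #5 over
cruxes #2 and #4: if poly-size {AND2,OR2}+CONV_{m^c} circuits (the convex door alone) and poly-size
{AND2,OR2}+PERM_{m^c}+GRANK_{m^c} circuits (the algebraic door alone) are each eventually blind to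
CLIQUE(m, ceil(m^delta)) for some delta in (0,1/2) and every c, then so are poly-size circuits over
the mixed basis B_{m^c} = {AND2,OR2}+CONV+PERM+GRANK (each hypothesis carries its own delta; the
conclusion may pick a third). ROLE: this implication item is what puts #2 and #4 into the cone of
the proved deciding theorem `closes : Capture → CliqueExtLowerBound → CliqueBridge → PneNP` (read
backwards: #5 <- #2, #4 via this item; `closes` is unchanged and never uses this item), so the
lower-bound half of the thesis closes EITHER by #5 directly OR by #2 + #4 + this item; the converse
edges #5 → #2 and #5 → #4 are immediate (sub-bases, Circuit.IsOver.mono; refuter glue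
G1.lean/W1.lean on the rev-1 items). HONEST STATUS — not provable now and not a formality: as a bare
implication the hypotheses give no black -/
@[route_item "route-PneNP-ConvexRankGates"]
def MixedBasisSynthesis : Prop :=
  ConvexGateBlind → LinAlgGateBlind → CliqueExtLowerBound

/-- item stmt-PneNP-2664 · support · rank 9 · closed · proved by Summit.PneNP.PneNP.Theorems.xorUnsatIsOnePermGate_proof (prover) · by planner
sources: GoosKamathRobereSokolov2019, FurstHopcroftLuks1980
[support] Sanity of the PERM gate: monotone XOR-UNSAT on n variables (input = a subset of the affine
equations a·y = b over GF(2); output = the selected system is unsatisfiable — the GKRS monotone NC2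
function with superpolynomial monotone circuit complexity) is computed by a size-1 circuit whose
gate is a PERM gate on 2n+2 points: embed (Z/2)^{n+1} in Sym(2n+2) as products of disjoint
transpositions, send equation (a,b) to the image of (a,b) and take the image of (0,...,0,1) as
target; the selected system is unsatisfiable iff (0,1) lies in the span of the selected (a_e,b_e)
(Fredholm alternative over GF(2)), i.e. iff the target lies in the generated subgroup. [sources:
GoosKamathRobereSokolov2019; FurstHopcroftLuks1980] -/
@[route_item "route-PneNP-ConvexRankGates"]
def XorUnsatIsOnePermGate : Prop :=
  let Perm : ℕ → Set Literature.Computability.Complexity.GateFn := fun s => {g | ∃ d : ℕ, d ≤ s ∧ ∃ (σ : Fin g.1 → Equiv.Perm (Fin d)) (τ : Equiv.Perm (Fin d)), ∀ v : Fin g.1 → Bool, g.2 v = true ↔ τ ∈ Subgroup.closure (σ '' {i | v i = true})}; ∀ n : ℕ, ∃ C : Literature.Computability.Complexity.Circuit ((Fin n → ZMod 2) × ZMod 2), C.IsOver (Perm (2 * n + 2)) ∧ C.size = 1 ∧ C.Computes (fun v => decide (¬ ∃ y : Fin n → ZMod 2, ∀ e : (Fin n → ZMod 2) × ZMod 2,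 v e = true → e.1 ⬝ᵥ y = e.2))

/-- item stmt-PneNP-2665 · support · rank 9 · closed · proved by Summit.PneNP.PneNP.Theorems.bpmIsOneRankGate_proof (prover) · by planner
sources: Edmonds1967, Tutte1947, OliveiraPudlak2019
[support] Sanity of the GRANK gate: bipartite perfect matching on Fin n × Fin n is computed by a
size-1 circuit whose gate is a GRANK gate of dimension n — K0 = 0, K_(i,j) = E_ij, theta = n, F = ℚ
say (Edmonds1967: the symbolic matrix sum_{selected (i,j)} x_(i,j) E_ij has generic rank n iff a
perfect matching exists; det = sum over permutations and distinct permutations give distinct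
monomials, so det != 0 iff some permutation is supported). General perfect matching via the Tutte
matrix (Tutte1947) and OliveiraPudlak2019 Thm 5.2 (BPM as one LP gate) are the next sanity targets,
not filed. [sources: Edmonds1967; Tutte1947; OliveiraPudlak2019] -/
@[route_item "route-PneNP-ConvexRankGates"]
def BpmIsOneRankGate : Prop :=
  let GRank : ℕ → Set Literature.Computability.Complexity.GateFn := fun s => {g | ∃ (F : Type) (_ : Field F) (d θ : ℕ), d ≤ s ∧ ∃ (K₀ : Matrix (Fin d) (Fin d) F) (K : Fin g.1 → Matrix (Fin d) (Fin d) F), ∀ v : Fin g.1 → Bool, g.2 v = true ↔ θ ≤ (K₀.map (algebraMap F (FractionRing (MvPolynomial (Fin g.1) F))) + ∑ i, if v i then (algebraMap (MvPolynomial (Fin g.1) F) (FractionRing (MvPolynomial (Fin g.1) F)) (MvPolynomial.X i)) • (K i).map (algebraMap F (FractionRing (MvPolynomial (Fin g.1) F))) else 0).rank}; ∀ n : ℕ, ∃ C : Literature.Computability.Complexity.Circuit (Fin n × Fin n), C.IsOver (GRank n) ∧ C.size = 1 ∧ C.Computes (fun v => decide (∃ σ : Equiv.Perm (Fin n), ∀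 i, v (i, σ i) = true))

-- earlier Assembly (stmt-PneNP-2666, replaced 2026-08-15T22:50:14Z -> stmt-PneNP-13895): proved by Summit.PneNP.PneNP.Theorems.convexRankGates_assembly_proof @ 9f1b15a2dded — Capture → CliqueExtLowerBound → CliqueBridge → PneNP
/-- item stmt-PneNP-13895 · assembly · rank 1 · closed · proved by Summit.PneNP.PneNP.Theorems.convexRankGates_assembly_rev5_proof (prover) · by planner
sources: AroraBarak2009
[assembly] rev 5 (route-repair, glue-native-fail): the two cruxes ALONE decide the Statement —
`Capture → CliqueExtLowerBound → PneNP`. Proof plan (provable as soon as the support item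
CliqueBridge, stmt-PneNP-10683, is proved; no mathematics beyond it): `fun hCap hLB => closes hCap
hLB hBridge` with `hBridge : CliqueBridge` — the deciding theorem `closes : Capture →
CliqueExtLowerBound → CliqueBridge → PneNP` is proved in this file (45 lines: monotonicity of
CLIQUE, Capture applied to the B2-circuit, (t + #E(K_m) + 2)^a ≤ m^((c+3)a) for m ≥ 3, gate classes
monotone in s) and natively certified. WHY RESTATED: the rev ≤ 4 Assembly (stmt-PneNP-2666) was
literally the type of `closes` and was proved 2026-08-15T22:11Z by
`Summit.PneNP.PneNP.Theorems.convexRankGates_assembly_proof` (Theorems/ConvexRankGatesAssembly.lean,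
`exact closes`), a file that IMPORTS this route file; the gate then auto-imported that module here
for the `Assembly_holds` link — an import cycle, every decl 'already declared', route flagged
needs_materialise and the deciding theorem de-certified although its proof never changed. The proved
record stays below as the replaced item; this statement is strictly stronger ( -/
@[route_item "route-PneNP-ConvexRankGates"]
def Assembly : Prop :=
  Capture → CliqueExtLowerBound → PneNP

/-! D-0027 §2.1 — DECIDING THEOREM (planner-authored via `route open/edit --closes-file`; by planner-rglue-PneNP-ConvexRankGates-8496846d-0 2026-08-15T22:50:14Z):
its hypotheses are this route's items and its conclusion the sub-problem Statement (glue_lint), and it elaborates with this file. -/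

@[closes "route-PneNP-ConvexRankGates"] theorem closes (hCap : Capture) (hLB : CliqueExtLowerBound) (hBridge : CliqueBridge) : PneNP := by
  apply hBridge
  obtain ⟨δ, hδ0, hδ1, hlb⟩ := hLB
  obtain ⟨a, hcap⟩ := hCap
  refine ⟨δ, hδ0, hδ1, fun c => ?_⟩
  filter_upwards [hlb ((c + 3) * a), Filter.eventually_ge_atTop 3] with m hm h3 C hB2 hsize hcomp
  -- Capture: simulate the B2-circuit by an extended-basis circuit of polynomial size
  obtain ⟨C', hC'over, hC'size, hC'comp⟩ := hcap _ inferInstance _ (by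
      -- the clique function is monotone: adding edges preserves cliques
      intro x y hxy
      apply Bool.le_iff_imp.2
      simp only [decide_eq_true_eq]
      intro hx hy
      refine hx (hy.anti (SimpleGraph.fromEdgeSet_mono ?_))
      rintro e ⟨he, hxe⟩
      refine ⟨he, ?_⟩
      have hle := hxy ⟨e, he⟩
      rw [hxe] at hle
      exact top_le_iff.1 hle) C hB2 hcomp
  -- size bookkeeping: (C.size + #E(K_m) + 2) ^ a ≤ m ^ ((c + 3) * a) for m ≥ 3
  have h1 : 1 ≤ m := le_trans (by norm_num) h3
  have hcard : Fintype.card ((⊤ : SimpleGraph (Fin m)).edgeSet) ≤ m ^ (c + 2) := by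
    calc Fintype.card ((⊤ : SimpleGraph (Fin m)).edgeSet)
        ≤ Fintype.card (Sym2 (Fin m)) := Fintype.card_le_of_injective Subtype.val Subtype.val_injective
      _ ≤ Fintype.card (Fin m × Fin m) :=
          Fintype.card_le_of_surjective (Sym2.mk (α := Fin m)).uncurry Sym2.mk_surjective
      _ = m ^ 2 := by simp [sq]
      _ ≤ m ^ (c + 2) := Nat.pow_le_pow_right h1 (by omega)
  have hsz : C.size ≤ m ^ (c + 2) := hsize.trans (Nat.pow_le_pow_right h1 (by omega))
  have htwo : 2 ≤ m ^ (c + 2) := by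
    calc 2 ≤ m := by omega
      _ = m ^ 1 := (pow_one m).symm
      _ ≤ m ^ (c + 2) := Nat.pow_le_pow_right h1 (by omega)
  have hN : C.size + Fintype.card ((⊤ : SimpleGraph (Fin m)).edgeSet) + 2 ≤ m ^ (c + 3) := by
    calc C.size + Fintype.card ((⊤ : SimpleGraph (Fin m)).edgeSet) + 2
        ≤ m ^ (c + 2) + m ^ (c + 2) + m ^ (c + 2) := by omega
      _ = 3 * m ^ (c + 2) := by ring
      _ ≤ m * m ^ (c + 2) := Nat.mul_le_mul_right _ h3
      _ = m ^ (c + 3) := by ring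
  have hbound : (C.size + Fintype.card ((⊤ : SimpleGraph (Fin m)).edgeSet) + 2) ^ a ≤ m ^ ((c + 3) * a) := by
    rw [pow_mul]
    exact Nat.pow_le_pow_left hN a
  -- the extended gate classes grow with the size parameter, so C' is a B_{m^c'}-circuit: contradiction
  refine hm C' (fun g hg => ?_) (hC'size.trans hbound) hC'comp
  have hgm := hC'over g hg
  simp only [Set.mem_setOf_eq] at hgm ⊢
  rcases hgm with h | h | ⟨p, q, hpq, hrest⟩ | ⟨d, hd, hrest⟩ | ⟨F, hF, d, θ, hd, hrest⟩
  · exact Or.inl h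
  · exact Or.inr (Or.inl h)
  · exact Or.inr (Or.inr (Or.inl ⟨p, q, hpq.trans hbound, hrest⟩))
  · exact Or.inr (Or.inr (Or.inr (Or.inl ⟨d, hd.trans hbound, hrest⟩)))
  · exact Or.inr (Or.inr (Or.inr (Or.inr ⟨F, hF, d, θ, hd.trans hbound, hrest⟩)))

end Summit.PneNP.PneNP.Theses.ConvexRankGates
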